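import Literature.AnabelianGeometry.EtaleTheta.Discharge.Sec3Prop34iPhiZero
import Literature.AnabelianGeometry.EtaleTheta.Discharge.Sec3Prop34iDivPlusInvariants
import Literature.AlgebraicGeometry.Frobenioids.PerfFactorialWeakAutRigid
import HarnessLib

/-!
# [EtTh] Prop. 3.4 (i), non-dilating clause: EVERY automorphism of `Div⁺(Z^log_∞)`, of its Galois invariants
# `Div⁺(Z^log_∞)^Γ`, and of `Φ₀(S) = Hom_G(S, Div⁺(Z^log_∞))` is non-dilating

Mochizuki, *The étale theta function and its Frobenioid-theoretic manifestations*, Publ. RIMS **45** (2009), §3,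
Prop. 3.4 (i), PDF p. 74 (printed 300); [FrdI] Def. 1.1 (i) p. 19 (non-dilating endomorphisms)
[cite: MochizukiEtTh2009, Prop 3.4 p.74].

abc-iut cell, block C / W6 cone prover abc-iut-w6-d057, W6-TRANCHE-2 row **EtTh:Prop3.4(i)**, clause (b), automorphism
form.  PROOF-ONLY (theorems only).  STRENGTHENS `Sec3Prop34iNonDilating.lean` (p433953: endomorphisms of `Div⁺` induced
by an automorphism of `DIV⁺`) by the general engine `Frobenioids/PerfFactorialWeakAutRigid.lean` (p437748: every
automorphism of a weakly perf-factorial monoid with `ℤ`-monoprime prime components is non-dilating — the factorization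
map of [FrdI] Def. 2.4 (i)(c) is rigid): NO inducing automorphism of `DIV⁺` is needed, and the same holds for the
Galois invariants (p433826) and for abc-iut-w6-d058's `Φ₀`-pieces `Hom_G(S, Div⁺)` (p436163; weakly perf-factorial with
`ℤ`-monoprime components by `Sec3Prop34iPhiZero.lean`, p436557).  The pull-back endomorphisms `Φ₀(f)` along arbitrary
`G`-maps `f : S → S` (not automorphisms in general) are abc-iut-w6-d058's `GaloisAction.isNonDilating_phiZeroPull`
(`Sec3Prop34iConnectedOfGaloisCovering.lean`, p438397) — not restated here.

HONEST FRAMING: statements about the typed interface (`LogDivisorModel`, `GaloisAction` are records; nothing asserts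
they arise from a curve); no side is taken on [IUTchIII] Cor. 3.12; typed ≠ proved for anything else.
-/

namespace Literature.AnabelianGeometry.EtaleTheta

open CategoryTheory Literature.AlgebraicGeometry.Frobenioids Function

universe u

namespace LogDivisorModel

variable (Z : LogDivisorModel.{u})

/-- **Every automorphism of `Div⁺(Z^log_∞)` is non-dilating** ([FrdI] Def. 1.1 (i)).
[cite: MochizukiEtTh2009, Prop 3.4 p.74] -/
theorem isNonDilating_Divplus_mulEquiv (α : ↥Z.Divplus ≃* ↥Z.Divplus) :
    IsNonDilating (α : ↥Z.Divplus →* ↥Z.Divplus) :=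
  Z.isPerfFactorialWeak_Divplus.isNonDilating_mulEquiv Z.isZMonoprime_submonoid_primes_Divplus α

/-- Every BIJECTIVE endomorphism of `Div⁺(Z^log_∞)` is non-dilating. [cite: MochizukiEtTh2009, Prop 3.4 p.74] -/
theorem isNonDilating_Divplus_of_bijective (φ : ↥Z.Divplus →* ↥Z.Divplus) (hφ : Bijective φ) : IsNonDilating φ :=
  Z.isPerfFactorialWeak_Divplus.isNonDilating_of_bijective Z.isZMonoprime_submonoid_primes_Divplus φ hφ

/-- An automorphism `α` of `Div⁺(Z^log_∞)` with `α(a) ≼ a` for every primary `a` is the identity (rigidity).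
[cite: MochizukiEtTh2009, Prop 3.4 p.74] -/
theorem Divplus_mulEquiv_apply_eq_self (α : ↥Z.Divplus ≃* ↥Z.Divplus)
    (h : ∀ a : ↥Z.Divplus, IsPrimary a → α a ≼ a) (x : ↥Z.Divplus) : α x = x :=
  Z.isPerfFactorialWeak_Divplus.mulEquiv_apply_eq_self_of_forall_isPrimary_precsim
    Z.isZMonoprime_submonoid_primes_Divplus α h x

variable (Γ : Subgroup (MulAut ↥Z.DIVplus))

/-- **Every automorphism of the Galois invariants `Div⁺(Z^log_∞)^Γ = Div⁺ ∩ (DIV⁺)^Γ` is non-dilating.**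
[cite: MochizukiEtTh2009, Prop 3.4 p.74] -/
theorem isNonDilating_Divplus_fixedPoints_mulEquiv
    (α : ↥((Z.Divplus.comap Z.DIVplus.subtype).comap (FixedPoints.submonoid Γ ↥Z.DIVplus).subtype) ≃*
      ↥((Z.Divplus.comap Z.DIVplus.subtype).comap (FixedPoints.submonoid Γ ↥Z.DIVplus).subtype)) :
    IsNonDilating (α : ↥((Z.Divplus.comap Z.DIVplus.subtype).comap (FixedPoints.submonoid Γ ↥Z.DIVplus).subtype) →*
      ↥((Z.Divplus.comap Z.DIVplus.subtype).comap (FixedPoints.submonoid Γ ↥Z.DIVplus).subtype)) :=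
  (Z.isPerfFactorialWeak_Divplus_fixedPoints Γ).isNonDilating_mulEquiv
    (Z.isZMonoprime_submonoid_primes_Divplus_fixedPoints Γ) α

end LogDivisorModel

namespace LogDivisorModel.GaloisAction

variable {Z : LogDivisorModel.{u}} {G : Type u} [Group G] (A : Z.GaloisAction G) (S : Action (Type u) G)

/-- **Every automorphism of `Φ₀(S) = Hom_G(S, Div⁺(Z^log_∞))` is non-dilating** (for every `G`-set `S`).
[cite: MochizukiEtTh2009, Prop 3.4 p.74] -/
theorem isNonDilating_phiZero_mulEquiv (α : ↥(A.phiZero S) ≃* ↥(A.phiZero S)) :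
    IsNonDilating (α : ↥(A.phiZero S) →* ↥(A.phiZero S)) := by
  obtain ⟨hw, -⟩ := A.isPerfFactorialCof_phiZero S
  exact hw.isNonDilating_mulEquiv (A.isZMonoprime_submonoid_primes_phiZero S) α

/-- Every bijective endomorphism of `Φ₀(S)` is non-dilating. [cite: MochizukiEtTh2009, Prop 3.4 p.74] -/
theorem isNonDilating_phiZero_of_bijective (φ : ↥(A.phiZero S) →* ↥(A.phiZero S)) (hφ : Bijective φ) :
    IsNonDilating φ := by
  obtain ⟨hw, -⟩ := A.isPerfFactorialCof_phiZero S
  exact hw.isNonDilating_of_bijective (A.isZMonoprime_submonoid_primes_phiZero S) φ hφ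

/-- An automorphism `α` of `Φ₀(S)` with `α(a) ≼ a` for every primary `a` is the identity (rigidity).
[cite: MochizukiEtTh2009, Prop 3.4 p.74] -/
theorem phiZero_mulEquiv_apply_eq_self (α : ↥(A.phiZero S) ≃* ↥(A.phiZero S))
    (h : ∀ a : ↥(A.phiZero S), IsPrimary a → α a ≼ a) (x : ↥(A.phiZero S)) : α x = x := by
  obtain ⟨hw, -⟩ := A.isPerfFactorialCof_phiZero S
  exact hw.mulEquiv_apply_eq_self_of_forall_isPrimary_precsim (A.isZMonoprime_submonoid_primes_phiZero S) α h x

end LogDivisorModel.GaloisAction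

end Literature.AnabelianGeometry.EtaleTheta
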